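import Literature.AlgebraicGeometry.ShimuraVarieties.UnitaryBallSpecialCycleClosed
import Literature.Geometry.ComplexHyperbolic.UnitBallQuotientManifold
import HarnessLib

/-!
# The special sub-disc `𝔹(s^⊥) ⊆ 𝔹²` of a compact ball-quotient datum as a complex `1`-manifold

Topic `AlgebraicGeometry/ShimuraVarieties`; namespace
`Literature.AlgebraicGeometry.ShimuraVarieties.UnitaryBallUniformisationDatum`.  For
`D : UnitaryBallUniformisationDatum 2 X`, a Sylvester frame `𝔣` and `s ∈ V = E³`, the special sub-ball
`𝔹(s^⊥) = D.specialBall 𝔣 {s} ⊆ 𝔹²` (`UnitaryBallSpecialCycleFinite`) is the trace on the ball of the affine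
complex line `{b₀ z₀ + b₁ z₁ + b₂ = 0}`, `b = D.ballVec 𝔣 s` (`mem_specialBall_singleton_iff`).  PROVED here:

* §2 the explicit affine parametrisation `t ↦ p + t d` / coordinate `ℓ` of that line (`discParam`, `discCoord`,
  inverse to each other on the line when `(b₀, b₁) ≠ 0`);
* §3 for `s : D.DiscVec 𝔣` (i.e. `s ≠ 0` with `𝔹(s^⊥) ≠ ∅` — any generator of a totally positive line) the type
  `D.specialDisc 𝔣 s` of the sub-disc is a non-empty, Hausdorff, locally compact COMPLEX `1`-MANIFOLD: one chart
  `discChart : 𝔹(s^⊥) → ℂ¹`, an open embedding onto the disc `discDom = {t | |p + t d|² < 1}`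
  (`instChartedSpaceSpecialDisc`, `instIsManifoldSpecialDisc`, via Mathlib's `IsOpenEmbedding.singletonChartedSpace`),
  and the inclusion `𝔹(s^⊥) → 𝔹²` is holomorphic (`contMDiff_specialDisc_val`).

Sequel files: `UnitaryBallSpecialDiscAction` (the free properly discontinuous holomorphic action of the stabiliser
`Γ_W` and the quotient curve `Γ_W∖𝔹_W → S(Γ)`), `UnitaryBallSpecialCurveEmbedding` (closed embedding and
compactness at injective level).  Everything is PROVED; no named facts; the carriers are definitions with bodies.

References: S. Kudla, J. Millson, Publ. Math. IHÉS 71 (1990), Lemma 1.1 p. 128 («`j₁` is a proper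
embedding onto a totally geodesic submanifold»); N. Bergeron, J. Millson, C. Moeglin, Acta Math. 216
(2016), Introduction §§1.1, 1.7, Part 2 §§1.3, 3.1–3.3; W. Rudin, *Function Theory in the Unit Ball of ℂⁿ*
(1980), §2.2; P. Deligne, *Travaux de Shimura*, Sém. Bourbaki 389 (1971), Prop. 1.15; J. M. Lee,
*Introduction to Smooth Manifolds*, 2nd ed., Thm. 21.13.
Written for the cell `hodgecm-mathlib` (road (ii) «embedded-curve descent», census `CENSUS-GS3-of-Mumford`
§4 R2-2 / `CENSUS-R2-2-Q2`): the manifold-level input of the algebraisation of special CURVES as smooth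
projective closed subschemes (Serre GAGA §2 n°6 via the tree's `ProjectiveManifold.isSmoothProjective_of_isAnalytification`).
HC_CM is proved only modulo the 7 printed citations until rung 0 closes; nothing here is in a registered cone.
-/

set_option autoImplicit false

noncomputable section

open scoped Manifold ContDiff Topology
open Matrix Complex ComplexConjugate Set Function MulAction
open Literature.Geometry.ComplexHyperbolic
open Literature.Geometry.ComplexHyperbolic.BallModel

namespace Literature.AlgebraicGeometry.ShimuraVarieties

namespace UnitaryBallUniformisationDatum

open Literature.AlgebraicGeometry.Motives (SchemeOver ComplexPoints)

variable {X₂ : SchemeOver ℂ} (D : UnitaryBallUniformisationDatum 2 X₂) (𝔣 : D.SylvesterFrame)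

/-! ### §2 The affine line of a special sub-ball -/

section Algebra

/-- `b₀ (p + t d)₀ + b₁ (p + t d)₁ + b₂ = 0` for the explicit base point and direction. [folklore] -/
private theorem alg_on_line (b0 b1 b2 t N : ℂ) (hN : N ≠ 0) (hNe : N = conj b0 * b0 + conj b1 * b1) :
    b0 * (-b2 * conj b0 / N + t * b1) + b1 * (-b2 * conj b1 / N - t * b0) + b2 = 0 := by
  field_simp
  linear_combination b2 * hNe

/-- `ℓ(p + t d) = t`. [folklore] -/
private theorem alg_coord_param (b0 b1 b2 t N : ℂ) (hN : N ≠ 0) (hNe : N = conj b0 * b0 + conj b1 * b1) :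
    (conj b1 * (-b2 * conj b0 / N + t * b1) - conj b0 * (-b2 * conj b1 / N - t * b0)) / N = t := by
  field_simp
  linear_combination (-(N * t)) * hNe

/-- `(p + ℓ(y) d)₀ = y₀` on the line. [folklore] -/
private theorem alg_param_coord_zero (b0 b1 b2 N : ℂ) (y : Fin 2 → ℂ) (hN : N ≠ 0)
    (hNe : N = conj b0 * b0 + conj b1 * b1) (hy : b0 * y 0 + b1 * y 1 + b2 = 0) :
    -b2 * conj b0 / N + (conj b1 * y 0 - conj b0 * y 1) / N * b1 = y 0 := by
  field_simp
  linear_combination (-conj b0) * hy + (-(y 0)) * hNe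

/-- `(p + ℓ(y) d)₁ = y₁` on the line. [folklore] -/
private theorem alg_param_coord_one (b0 b1 b2 N : ℂ) (y : Fin 2 → ℂ) (hN : N ≠ 0)
    (hNe : N = conj b0 * b0 + conj b1 * b1) (hy : b0 * y 0 + b1 * y 1 + b2 = 0) :
    -b2 * conj b1 / N - (conj b1 * y 0 - conj b0 * y 1) / N * b0 = y 1 := by
  field_simp
  linear_combination (-conj b1) * hy + (-(y 1)) * hNe

end Algebra

section Line

variable (s : Fin 3 → D.E)

/-- The squared length `|b₀|² + |b₁|²` of the linear part of the equation `b₀ z₀ + b₁ z₁ + b₂ = 0` of the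
sub-ball, `b = D.ballVec 𝔣 s`. [cite: BergeronMillsonMoeglin2016Balls, Part 2 §3.3] -/
def discNorm : ℝ := Complex.normSq (D.ballVec 𝔣 s 0) + Complex.normSq (D.ballVec 𝔣 s 1)

/-- `|b₀|² + |b₁|² ≥ 0`. [cite: BergeronMillsonMoeglin2016Balls, Part 2 §3.3] -/
theorem discNorm_nonneg : 0 ≤ D.discNorm 𝔣 s :=
  add_nonneg (Complex.normSq_nonneg _) (Complex.normSq_nonneg _)

/-- Non-degeneracy means `|b₀|² + |b₁|² > 0`. [cite: BergeronMillsonMoeglin2016Balls, Part 2 §3.3] -/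
theorem discNorm_pos (h : D.ballVec 𝔣 s 0 ≠ 0 ∨ D.ballVec 𝔣 s 1 ≠ 0) : 0 < D.discNorm 𝔣 s := by
  rcases h with h | h
  · exact add_pos_of_pos_of_nonneg (Complex.normSq_pos.2 h) (Complex.normSq_nonneg _)
  · exact add_pos_of_nonneg_of_pos (Complex.normSq_nonneg _) (Complex.normSq_pos.2 h)

/-- … and in particular `|b₀|² + |b₁|² ≠ 0` in `ℂ`. [cite: BergeronMillsonMoeglin2016Balls, Part 2 §3.3] -/
theorem discNorm_ne_zero (h : D.ballVec 𝔣 s 0 ≠ 0 ∨ D.ballVec 𝔣 s 1 ≠ 0) : ((D.discNorm 𝔣 s : ℝ) : ℂ) ≠ 0 :=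
  Complex.ofReal_ne_zero.2 (D.discNorm_pos 𝔣 s h).ne'

/-- `(|b₀|² + |b₁|² : ℂ) = b̄₀ b₀ + b̄₁ b₁`. [cite: BergeronMillsonMoeglin2016Balls, Part 2 §3.3] -/
theorem discNorm_eq :
    ((D.discNorm 𝔣 s : ℝ) : ℂ) =
      conj (D.ballVec 𝔣 s 0) * D.ballVec 𝔣 s 0 + conj (D.ballVec 𝔣 s 1) * D.ballVec 𝔣 s 1 := by
  rw [discNorm, Complex.ofReal_add, Complex.normSq_eq_conj_mul_self, Complex.normSq_eq_conj_mul_self]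

/-- A **direction vector** of the affine line `{b₀ z₀ + b₁ z₁ + b₂ = 0}`: `d = (b₁, -b₀)`. [folklore] -/
def discDir : Fin 2 → ℂ := ![D.ballVec 𝔣 s 1, -D.ballVec 𝔣 s 0]

/-- A **base point** of the affine line: `p = -b₂ (b̄₀, b̄₁) / (|b₀|² + |b₁|²)` (its point closest to the
origin). [folklore] -/
def discPt : Fin 2 → ℂ :=
  ![-D.ballVec 𝔣 s 2 * conj (D.ballVec 𝔣 s 0) / (D.discNorm 𝔣 s : ℝ),
    -D.ballVec 𝔣 s 2 * conj (D.ballVec 𝔣 s 1) / (D.discNorm 𝔣 s : ℝ)]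

/-- The **affine coordinate** on the line: `ℓ(y) = (b̄₁ y₀ - b̄₀ y₁) / (|b₀|² + |b₁|²)`, normalised so that
`ℓ(p + t d) = t`. [folklore] -/
def discCoord (y : Fin 2 → ℂ) : ℂ :=
  (conj (D.ballVec 𝔣 s 1) * y 0 - conj (D.ballVec 𝔣 s 0) * y 1) / (D.discNorm 𝔣 s : ℝ)

/-- The **affine parametrisation** of the line: `t ↦ p + t d`. [folklore] -/
def discParam (t : ℂ) : Fin 2 → ℂ := D.discPt 𝔣 s + t • D.discDir 𝔣 s

/-- Coordinates of the parametrisation. [cite: BergeronMillsonMoeglin2016Balls, Part 2 §3.3] -/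
theorem discParam_apply_zero (t : ℂ) :
    D.discParam 𝔣 s t 0 =
      -D.ballVec 𝔣 s 2 * conj (D.ballVec 𝔣 s 0) / (D.discNorm 𝔣 s : ℝ) + t * D.ballVec 𝔣 s 1 := by
  simp [discParam, discPt, discDir]

/-- Coordinates of the parametrisation. [cite: BergeronMillsonMoeglin2016Balls, Part 2 §3.3] -/
theorem discParam_apply_one (t : ℂ) :
    D.discParam 𝔣 s t 1 =
      -D.ballVec 𝔣 s 2 * conj (D.ballVec 𝔣 s 1) / (D.discNorm 𝔣 s : ℝ) - t * D.ballVec 𝔣 s 0 := by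
  simp [discParam, discPt, discDir, sub_eq_add_neg]

/-- The parametrisation lands on the line: `b₀ (p + t d)₀ + b₁ (p + t d)₁ + b₂ = 0`. [cite: BergeronMillsonMoeglin2016Balls, Part 2 §3.3] -/
theorem ballVec_eq_discParam (h : D.ballVec 𝔣 s 0 ≠ 0 ∨ D.ballVec 𝔣 s 1 ≠ 0) (t : ℂ) :
    D.ballVec 𝔣 s 0 * D.discParam 𝔣 s t 0 + D.ballVec 𝔣 s 1 * D.discParam 𝔣 s t 1 + D.ballVec 𝔣 s 2 = 0 := by
  rw [discParam_apply_zero, discParam_apply_one]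
  exact alg_on_line _ _ _ t _ (D.discNorm_ne_zero 𝔣 s h) (D.discNorm_eq 𝔣 s)

/-- `ℓ(p + t d) = t`. [cite: BergeronMillsonMoeglin2016Balls, Part 2 §3.3] -/
theorem discCoord_discParam (h : D.ballVec 𝔣 s 0 ≠ 0 ∨ D.ballVec 𝔣 s 1 ≠ 0) (t : ℂ) : D.discCoord 𝔣 s (D.discParam 𝔣 s t) = t := by
  rw [discCoord, discParam_apply_zero, discParam_apply_one]
  exact alg_coord_param _ _ _ t _ (D.discNorm_ne_zero 𝔣 s h) (D.discNorm_eq 𝔣 s)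

/-- A point of the line is `p + ℓ(y) d`. [cite: BergeronMillsonMoeglin2016Balls, Part 2 §3.3] -/
theorem discParam_discCoord (h : D.ballVec 𝔣 s 0 ≠ 0 ∨ D.ballVec 𝔣 s 1 ≠ 0) {y : Fin 2 → ℂ}
    (hy : D.ballVec 𝔣 s 0 * y 0 + D.ballVec 𝔣 s 1 * y 1 + D.ballVec 𝔣 s 2 = 0) :
    D.discParam 𝔣 s (D.discCoord 𝔣 s y) = y := by
  have hN := D.discNorm_ne_zero 𝔣 s h
  have hNe := D.discNorm_eq 𝔣 s
  funext i
  fin_cases i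
  · change D.discParam 𝔣 s (D.discCoord 𝔣 s y) 0 = y 0
    rw [discParam_apply_zero, discCoord]
    exact alg_param_coord_zero _ _ _ _ y hN hNe hy
  · change D.discParam 𝔣 s (D.discCoord 𝔣 s y) 1 = y 1
    rw [discParam_apply_one, discCoord]
    exact alg_param_coord_one _ _ _ _ y hN hNe hy

/-- The coordinate is continuous. [cite: BergeronMillsonMoeglin2016Balls, Part 2 §3.3] -/
theorem continuous_discCoord : Continuous (D.discCoord 𝔣 s) := by
  unfold discCoord
  fun_prop

/-- The coordinate is `ℂ`-differentiable (it is affine-linear). [cite: BergeronMillsonMoeglin2016Balls, Part 2 §3.3] -/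
theorem contDiff_discCoord {n : ℕ∞ω} : ContDiff ℂ n (D.discCoord 𝔣 s) := by
  unfold discCoord
  fun_prop

/-- The parametrisation is continuous. [cite: BergeronMillsonMoeglin2016Balls, Part 2 §3.3] -/
theorem continuous_discParam : Continuous (D.discParam 𝔣 s) := by
  unfold discParam
  fun_prop

/-- The parametrisation is `ℂ`-differentiable (affine). [cite: BergeronMillsonMoeglin2016Balls, Part 2 §3.3] -/
theorem contDiff_discParam {n : ℕ∞ω} : ContDiff ℂ n (D.discParam 𝔣 s) := by
  unfold discParam
  fun_prop

end Line

/-! ### §3 The sub-disc as a complex `1`-manifold -/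

/-- **Vectors with a genuine special disc**: `s ≠ 0` and `𝔹(s^⊥) ≠ ∅` — e.g. any generator of a totally
positive definite line (`UnitaryBallSpecialCycleNonvacuity`). Packaging the two conditions in the TYPE of
`s` makes the disc a NONEMPTY manifold without hypotheses, so that all its structures are instances.
[cite: BergeronMillsonMoeglin2016Balls, Part 2 §3.3] -/
abbrev DiscVec : Type := {s : Fin 3 → D.E // (D.specialBall 𝔣 {s}).Nonempty ∧ s ≠ 0}

section Disc

variable (s : D.DiscVec 𝔣)

/-- A vector with a genuine disc has a non-degenerate disc equation (`(b₀, b₁) ≠ 0`): otherwise the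
equation `b₂ = 0` at a point of the disc forces `b = 0`, i.e. `s = 0`. [cite: BergeronMillsonMoeglin2016Balls, Part 2 §3.3] -/
theorem DiscVec.discNondeg : D.ballVec 𝔣 s.1 0 ≠ 0 ∨ D.ballVec 𝔣 s.1 1 ≠ 0 := by
  by_contra h
  simp only [not_or, not_ne_iff] at h
  obtain ⟨z, hz⟩ := s.2.1
  have hz' := (D.mem_specialBall_singleton_iff 𝔣).1 hz
  rw [h.1, h.2, zero_mul, zero_mul, zero_add, zero_add] at hz'
  have hb : D.ballVec 𝔣 s.1 = 0 := by
    funext i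
    fin_cases i
    · exact h.1
    · exact h.2
    · exact hz'
  exact s.2.2 ((D.ballVec_eq_zero_iff 𝔣).1 hb)

/-- The **special sub-disc** `𝔹_W = 𝔹(s^⊥) ⊆ 𝔹²` of the line `W = E·s`, as a type (a non-empty closed
subset of the ball, the trace of an affine complex line). [cite: BergeronMillsonMoeglin2016Balls, Part 2 §3.3] -/
def specialDisc : Type := {z : Ball // z ∈ D.specialBall 𝔣 {s.1}}

/-- The topology of the sub-disc (subspace of the ball). [folklore] -/
instance instTopologicalSpaceSpecialDisc : TopologicalSpace (D.specialDisc 𝔣 s) :=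
  instTopologicalSpaceSubtype

/-- The sub-disc is non-empty. [cite: BergeronMillsonMoeglin2016Balls, Part 2 §3.3] -/
instance instNonemptySpecialDisc : Nonempty (D.specialDisc 𝔣 s) :=
  let ⟨z, hz⟩ := s.2.1; ⟨⟨z, hz⟩⟩

variable {s} in
/-- Extensionality: points of the sub-disc are equal iff they are equal in the ball. [cite: BergeronMillsonMoeglin2016Balls, Part 2 §3.3] -/
theorem specialDisc.ext {z w : D.specialDisc 𝔣 s} (h : z.1 = w.1) : z = w := Subtype.ext h

variable {s} in
/-- The equation of the sub-disc at a point: `b₀ z₀ + b₁ z₁ + b₂ = 0`. [cite: BergeronMillsonMoeglin2016Balls, Part 2 §3.3] -/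
theorem specialDisc.line_eq (z : D.specialDisc 𝔣 s) :
    D.ballVec 𝔣 s.1 0 * z.1.1 0 + D.ballVec 𝔣 s.1 1 * z.1.1 1 + D.ballVec 𝔣 s.1 2 = 0 :=
  (D.mem_specialBall_singleton_iff 𝔣).1 z.2

/-- The sub-disc is Hausdorff. [folklore] -/
instance instT2SpaceSpecialDisc : T2Space (D.specialDisc 𝔣 s) :=
  inferInstanceAs (T2Space {z : Ball // z ∈ D.specialBall 𝔣 {s.1}})

/-- The sub-disc is locally compact (a closed subset of the locally compact ball). [folklore] -/
instance instLocallyCompactSpaceSpecialDisc : LocallyCompactSpace (D.specialDisc 𝔣 s) :=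
  (D.isClosed_specialBall 𝔣 {s.1}).isClosedEmbedding_subtypeVal.locallyCompactSpace

/-- The **affine chart** of the sub-disc: `z ↦ ℓ(z) ∈ ℂ¹`. [cite: BergeronMillsonMoeglin2016Balls, Part 2 §3.3] -/
def discChart (z : D.specialDisc 𝔣 s) : Fin 1 → ℂ := fun _ ↦ D.discCoord 𝔣 s.1 z.1.1

/-- The chart recovers the point: `p + ℓ(z) d = z`. [cite: BergeronMillsonMoeglin2016Balls, Part 2 §3.3] -/
theorem discParam_discChart (z : D.specialDisc 𝔣 s) :
    D.discParam 𝔣 s.1 (D.discChart 𝔣 s z 0) = z.1.1 :=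
  D.discParam_discCoord 𝔣 s.1 (DiscVec.discNondeg D 𝔣 s) (specialDisc.line_eq D 𝔣 z)

/-- The chart is injective. [cite: BergeronMillsonMoeglin2016Balls, Part 2 §3.3] -/
theorem discChart_injective : Injective (D.discChart 𝔣 s) := by
  intro z w h
  apply specialDisc.ext
  apply BallModel.Ball.ext
  intro i
  have hz := D.discParam_discChart 𝔣 s z
  have hw := D.discParam_discChart 𝔣 s w
  rw [h] at hz
  rw [← hz, ← hw]

/-- The chart is continuous. [cite: BergeronMillsonMoeglin2016Balls, Part 2 §3.3] -/
theorem continuous_discChart : Continuous (D.discChart 𝔣 s) :=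
  continuous_pi fun _ ↦
    (D.continuous_discCoord 𝔣 s.1).comp (continuous_subtype_val.comp continuous_subtype_val)

/-- The **chart domain**: the open subset `{t | |p + t d|² < 1}` of `ℂ¹`.
[cite: BergeronMillsonMoeglin2016Balls, Part 2 §3.3] -/
def discDom : Set (Fin 1 → ℂ) := {t | nsq (D.discParam 𝔣 s.1 (t 0)) < 1}

/-- The chart domain is open. [cite: BergeronMillsonMoeglin2016Balls, Part 2 §3.3] -/
theorem isOpen_discDom : IsOpen (D.discDom 𝔣 s) := by
  have hp : Continuous fun t : Fin 1 → ℂ ↦ D.discParam 𝔣 s.1 (t 0) :=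
    (D.continuous_discParam 𝔣 s.1).comp (continuous_apply 0)
  have hc : Continuous fun t : Fin 1 → ℂ ↦ nsq (D.discParam 𝔣 s.1 (t 0)) :=
    (((continuous_apply 0).comp hp).norm.pow 2).add (((continuous_apply 1).comp hp).norm.pow 2)
  exact isOpen_lt hc continuous_const

/-- The inverse chart on the chart domain: `t ↦ p + t d`. [folklore] -/
def discInv (t : D.discDom 𝔣 s) : D.specialDisc 𝔣 s :=
  ⟨⟨D.discParam 𝔣 s.1 (t.1 0), t.2⟩,
    (D.mem_specialBall_singleton_iff 𝔣).2 (D.ballVec_eq_discParam 𝔣 s.1 (DiscVec.discNondeg D 𝔣 s) (t.1 0))⟩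

/-- The inverse chart is continuous. [cite: BergeronMillsonMoeglin2016Balls, Part 2 §3.3] -/
theorem continuous_discInv : Continuous (D.discInv 𝔣 s) := by
  refine Continuous.subtype_mk (Continuous.subtype_mk ?_ _) _
  exact (D.continuous_discParam 𝔣 s.1).comp ((continuous_apply 0).comp continuous_subtype_val)

/-- `chart ∘ inverse = id` on the chart domain. [cite: BergeronMillsonMoeglin2016Balls, Part 2 §3.3] -/
theorem discChart_discInv (t : D.discDom 𝔣 s) : D.discChart 𝔣 s (D.discInv 𝔣 s t) = t.1 := by
  funext i
  have hi : i = 0 := Subsingleton.elim i 0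
  subst hi
  exact D.discCoord_discParam 𝔣 s.1 (DiscVec.discNondeg D 𝔣 s) (t.1 0)

/-- `inverse ∘ chart = id`. [cite: BergeronMillsonMoeglin2016Balls, Part 2 §3.3] -/
theorem discInv_discChart (z : D.specialDisc 𝔣 s) (h : D.discChart 𝔣 s z ∈ D.discDom 𝔣 s) :
    D.discInv 𝔣 s ⟨D.discChart 𝔣 s z, h⟩ = z := by
  apply specialDisc.ext
  apply BallModel.Ball.ext
  intro i
  change D.discParam 𝔣 s.1 (D.discChart 𝔣 s z 0) i = z.1.1 i
  rw [D.discParam_discChart 𝔣 s z]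

/-- The chart lands in the chart domain. [cite: BergeronMillsonMoeglin2016Balls, Part 2 §3.3] -/
theorem discChart_mem_discDom (z : D.specialDisc 𝔣 s) : D.discChart 𝔣 s z ∈ D.discDom 𝔣 s := by
  change nsq (D.discParam 𝔣 s.1 (D.discChart 𝔣 s z 0)) < 1
  rw [D.discParam_discChart 𝔣 s z]
  exact z.1.2

/-- The image of the chart is the chart domain. [cite: BergeronMillsonMoeglin2016Balls, Part 2 §3.3] -/
theorem range_discChart : Set.range (D.discChart 𝔣 s) = D.discDom 𝔣 s := by
  refine Set.Subset.antisymm ?_ fun t ht ↦ ⟨D.discInv 𝔣 s ⟨t, ht⟩, D.discChart_discInv 𝔣 s ⟨t, ht⟩⟩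
  rintro _ ⟨z, rfl⟩
  exact D.discChart_mem_discDom 𝔣 s z

/-- The chart is an open map. [cite: BergeronMillsonMoeglin2016Balls, Part 2 §3.3] -/
theorem isOpenMap_discChart : IsOpenMap (D.discChart 𝔣 s) := by
  intro U hU
  have himage : D.discChart 𝔣 s '' U = Subtype.val '' (D.discInv 𝔣 s ⁻¹' U) := by
    ext t
    constructor
    · rintro ⟨z, hz, rfl⟩
      refine ⟨⟨D.discChart 𝔣 s z, D.discChart_mem_discDom 𝔣 s z⟩, ?_, rfl⟩
      change D.discInv 𝔣 s ⟨D.discChart 𝔣 s z, _⟩ ∈ U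
      rwa [D.discInv_discChart 𝔣 s z]
    · rintro ⟨τ, hτ, rfl⟩
      exact ⟨D.discInv 𝔣 s τ, hτ, D.discChart_discInv 𝔣 s τ⟩
  rw [himage]
  exact (D.isOpen_discDom 𝔣 s).isOpenMap_subtype_val _ (hU.preimage (D.continuous_discInv 𝔣 s))

/-- **The affine chart is an open embedding `𝔹(s^⊥) ↪ ℂ¹`.** [cite: BergeronMillsonMoeglin2016Balls, Part 2 §3.3] -/
theorem isOpenEmbedding_discChart : Topology.IsOpenEmbedding (D.discChart 𝔣 s) :=
  .of_continuous_injective_isOpenMap (D.continuous_discChart 𝔣 s) (D.discChart_injective 𝔣 s)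
    (D.isOpenMap_discChart 𝔣 s)

/-- **The complex chart of the sub-disc** (one chart: an open subset of `ℂ¹`). [cite: BergeronMillsonMoeglin2016Balls, Part 2 §3.3] -/
instance instChartedSpaceSpecialDisc : ChartedSpace (Fin 1 → ℂ) (D.specialDisc 𝔣 s) :=
  (D.isOpenEmbedding_discChart 𝔣 s).singletonChartedSpace

/-- **The sub-disc is a complex `1`-manifold** (holomorphic = `C^ω` structure). [cite: BergeronMillsonMoeglin2016Balls, Part 2 §3.3] -/
instance instIsManifoldSpecialDisc : IsManifold 𝓘(ℂ, Fin 1 → ℂ) ω (D.specialDisc 𝔣 s) :=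
  (D.isOpenEmbedding_discChart 𝔣 s).isManifold_singleton

/-- The chart is holomorphic. [cite: BergeronMillsonMoeglin2016Balls, Part 2 §3.3] -/
theorem contMDiff_discChart {n : ℕ∞ω} :
    ContMDiff 𝓘(ℂ, Fin 1 → ℂ) 𝓘(ℂ, Fin 1 → ℂ) n (D.discChart 𝔣 s) :=
  contMDiff_isOpenEmbedding (I := 𝓘(ℂ, Fin 1 → ℂ)) (D.isOpenEmbedding_discChart 𝔣 s)

/-- **The inclusion `𝔹(s^⊥) → 𝔹²` is holomorphic** (in the charts it is the affine map `t ↦ p + t d`).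
[cite: BergeronMillsonMoeglin2016Balls, Part 2 §3.3] -/
theorem contMDiff_specialDisc_val {n : ℕ∞ω} :
    ContMDiff 𝓘(ℂ, Fin 1 → ℂ) 𝓘(ℂ, Fin 2 → ℂ) n (fun z : D.specialDisc 𝔣 s ↦ z.1) := by
  have key : ContMDiff 𝓘(ℂ, Fin 1 → ℂ) 𝓘(ℂ, Fin 2 → ℂ) n
      ((fun z : Ball ↦ (z.1 : Fin 2 → ℂ)) ∘ fun z : D.specialDisc 𝔣 s ↦ z.1) := by
    have heq : ((fun z : Ball ↦ (z.1 : Fin 2 → ℂ)) ∘ fun z : D.specialDisc 𝔣 s ↦ z.1) =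
        (fun t : Fin 1 → ℂ ↦ D.discParam 𝔣 s.1 (t 0)) ∘ D.discChart 𝔣 s := by
      funext z
      exact (D.discParam_discChart 𝔣 s z).symm
    rw [heq]
    refine ContMDiff.comp ?_ (D.contMDiff_discChart 𝔣 s)
    exact ((D.contDiff_discParam 𝔣 s.1).comp (contDiff_apply ℂ ℂ 0)).contMDiff
  exact key.of_comp_isOpenEmbedding isOpenEmbedding_coe

end Disc


end UnitaryBallUniformisationDatum

end Literature.AlgebraicGeometry.ShimuraVarieties

end
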